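import Summits.BirchSwinnertonDyer.Rank1Residual.X12.O11.RouteUPrimePsi
import HarnessLib

/-!
# ROUTE U, generic ODD member `D = −m` (`m` squarefree, possibly COMPOSITE) — the ψ-layer
# `ψ_m = χ_{−m}·ω²` at level `7m` and the Bernoulli characters `θ₁ = χ_m↑·ω⁴↑`, `θ₂ = χ_m↑·κ_r↑·ω↑`,
# for a PRIMITIVE quadratic character `χ` mod `m` with Jacobi values `J(· | m)`

bsd-cm cell, ROUTE U (Theorem U: BSD(49a1^{(D)}, 7)), seat `bsd-cm-ram` (g5). `RouteUPrimePsi` did this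
layer for a PRIME `q` (`χ` = the Legendre character, primitive because `q` is prime). This file redoes
it for an arbitrary odd level `m` coprime to `7` and a character `χ` mod `m` that is ASSUMED primitive
with values `J(a | m)` (for `m = q₁q₂` such a `χ` is `χ_{q₁}↑·χ_{q₂}↑`, `RouteUPrimeTwin.jacobiCharMul_*`),
so that the composite odd members `D ∈ {−15, −39, −51, −55, −87, −95, …}` of the O11 class at `7` are
reachable by the same schema. Given `ω` mod `7` Teichmüller, `χ` mod `m` (primitive, Jacobi values),
`κ` mod `r` (Jacobi values):

* `jacobiChar_ne_one` — a primitive character of level `m ≠ 1` is non-trivial;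
* `psiJ_apply` (`ψ(j) = J(j|m)·ω(j)²`), `psiJ_isPrimitive` (conductor `7m`), `psiJ_odd` (`m ≡ 3 (4)`),
  `psiJ_apply_natCast_ne_one_of_not_coprime`, `primVal_invMulOmega_psiJ_ne_one` (KL19 (1)/(3));
* `psiJ_traceIdentity` — `ψ(ℓ) + ψ⁻¹(ℓ)ω(ℓ) = J(ℓ|m)(ω(ℓ)² + ω(ℓ)⁵)` for `ℓ` coprime to `7m`;
* `psiJ_inv_apply` (`ψ⁻¹(j) = J(j|m)ω(j)⁴`), `psiJ_inv_isPrimitive`, `thetaOneJ_apply`;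
* `bernoulliCharOne_psiJ` (`= (ψ⁻¹)↑`), `bernoulliCharTwo_psiJ` (`= θ₂↑`), `thetaTwoJ_apply`
  (`θ₂(j) = J(j|m)·J(j|r)·ω(j)`), `thetaTwoJ_isPrimitive` (conductor `7mr`, `κ` primitive).

THEOREMS ONLY; no definitions, no named facts; nothing booked. References: [KrizLi2019] Thm. 1.20,
§1.5, §2; [Washington1997] Ch. 3, §5.1; [Cox2013] §1.C Lemma 1.14.
-/

noncomputable section

open scoped Classical
open DirichletCharacter Literature.NumberTheory.EllipticCurves.KrizLi2019 Literature.NumberTheory.LFunctions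

namespace Summit.BirchSwinnertonDyer.Rank1Residual.X12.O11.RouteU

/-! ## §1 Primitive characters of level `m ≠ 1` are non-trivial -/

/-- A primitive character of level `m ≠ 1` is not the trivial character (the trivial character has
conductor `1`). [cite: Washington1997, Ch. 3 (conductor)] -/
theorem jacobiChar_ne_one {m : ℕ} [NeZero m] (χ : DirichletCharacter ℚ_[7] m)
    (hχp : χ.IsPrimitive) (hm1 : m ≠ 1) : χ ≠ 1 := by
  intro h
  have hc : χ.conductor = m := hχp
  rw [h, conductor_one] at hc
  exact hm1 hc.symm

/-! ## §2 `ψ_m = χ↑·(ω²)↑` at level `7m` -/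

section Psi

variable {m : ℕ} [hm : NeZero m] (ω : DirichletCharacter ℚ_[7] 7) (χ : DirichletCharacter ℚ_[7] m)

/-- `7m ≠ 0`. [folklore] -/
@[instance] theorem neZero_seven_mul_level : NeZero (7 * m) := ⟨Nat.mul_ne_zero (by norm_num) hm.out⟩

omit hm in
/-- `J((j mod 7m) | m) = J(j | m)`. [folklore] -/
theorem jacobiSym_val_zmod_seven_mul (ℓ : ℕ) :
    jacobiSym ((((ℓ : ZMod (7 * m))).val : ℕ) : ℤ) m = jacobiSym (ℓ : ℤ) m := by
  rw [ZMod.val_natCast, jacobiSym.mod_left (ℓ : ℤ) m,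
    jacobiSym.mod_left (((ℓ % (7 * m) : ℕ) : ℤ)) m]
  congr 1
  push_cast
  exact Int.emod_emod_of_dvd _ (by exact_mod_cast dvd_mul_left m 7)

omit hm in
/-- `J(a | m) = 0` when `a` is not coprime to `m`. [folklore] -/
theorem jacobiSym_eq_zero_of_not_coprime {a : ℕ} (h : ¬ a.Coprime m) (hm0 : m ≠ 0) :
    jacobiSym (a : ℤ) m = 0 := by
  refine jacobiSym.eq_zero_iff.mpr ⟨hm0, fun h1 => h ?_⟩
  have : Int.gcd (a : ℤ) (m : ℕ) = 1 := h1
  rwa [Int.gcd_natCast_natCast] at this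

omit hm in
/-- `J(a | m)² = 1` when `a` is coprime to `m` (as an element of `ℚ₇`). [folklore] -/
theorem jacobiSym_sq_eq_one_of_coprime {a : ℕ} (h : a.Coprime m) :
    ((jacobiSym (a : ℤ) m : ℤ) : ℚ_[7]) ^ 2 = 1 := by
  have hg : (a : ℤ).gcd m = 1 := by rw [Int.gcd_natCast_natCast]; exact h
  rcases jacobiSym.eq_one_or_neg_one hg with h1 | h1 <;> rw [h1] <;> norm_num

/-- **Values of `ψ_m = χ↑·(ω²)↑` at level `7m`: `ψ(j) = J(j|m)·ω(j)²`** (units: `changeLevel`;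
non-units: both sides vanish). [cite: KrizLi2019, §2 (p. 11, conventions on characters)] -/
theorem psiJ_apply
    (hχ : ∀ a : ℕ, χ (a : ZMod m) = (jacobiSym (a : ℤ) m : ℚ_[7])) (j : ZMod (7 * m)) :
    (changeLevel (dvd_mul_left m 7) χ * changeLevel (dvd_mul_right 7 m) (ω ^ 2) :
      DirichletCharacter ℚ_[7] (7 * m)) j =
      (jacobiSym (j.val : ℤ) m : ℚ_[7]) * ω (j.val : ZMod 7) ^ 2 := by
  have hj : ((j.val : ℤ) : ZMod (7 * m)) = j := by rw [Int.cast_natCast, ZMod.natCast_zmod_val]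
  by_cases hu : IsCoprime (j.val : ℤ) ((7 * m : ℕ) : ℤ)
  · conv_lhs => rw [← hj]
    rw [MulChar.mul_apply, changeLevel_eq_cast_of_dvd' _ _ hu, changeLevel_eq_cast_of_dvd' _ _ hu,
      MulChar.pow_apply' _ two_ne_zero, Int.cast_natCast, Int.cast_natCast, hχ]
  · have hnu : ¬ IsUnit j := by
      rw [← hj, ZMod.coe_int_isUnit_iff_isCoprime]; exact fun h => hu (by simpa [isCoprime_comm] using h)
    rw [MulChar.map_nonunit _ hnu]
    have h77 : ¬ (j.val).Coprime (7 * m) := fun h => hu (Nat.isCoprime_iff_coprime.mpr h)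
    rw [Nat.coprime_mul_iff_right, not_and_or] at h77
    rcases h77 with h7 | hmm
    · have hd : 7 ∣ j.val := by
        rwa [Nat.coprime_comm, Nat.Prime.coprime_iff_not_dvd (by norm_num), not_not] at h7
      have h0 : (j.val : ZMod 7) = 0 := (ZMod.natCast_eq_zero_iff _ _).mpr hd
      rw [h0, MulChar.map_zero, zero_pow two_ne_zero, mul_zero]
    · rw [jacobiSym_eq_zero_of_not_coprime hmm hm.out, Int.cast_zero, zero_mul]

/-- **`ψ_m` is primitive of conductor `7m`** (`χ` primitive mod `m`, `m` coprime to `7`).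
[cite: KrizLi2019, Thm. 1.20 (p. 7)] [cite: Washington1997, Ch. 3] -/
theorem psiJ_isPrimitive (hm7 : m.Coprime 7) (hω : IsTeichmullerCharacter ω) (hχp : χ.IsPrimitive) :
    (changeLevel (dvd_mul_left m 7) χ * changeLevel (dvd_mul_right 7 m) (ω ^ 2) :
      DirichletCharacter ℚ_[7] (7 * m)).IsPrimitive := by
  have hcq : χ.conductor = m := hχp
  have hc7 := conductor_eq_of_prime_of_ne_one (ω ^ 2) (teichmuller_sq_ne_one ω hω)
  rw [isPrimitive_def, conductor_changeLevel_mul_changeLevel _ _ χ (ω ^ 2) (by rw [hcq, hc7]; exact hm7),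
    hcq, hc7, mul_comm]

omit hm in
/-- **(1a)/(3a) for `ψ_m`: `ψ(a) ≠ 1` whenever `a` is not coprime to `7m`** (the value is `0`).
[cite: KrizLi2019, Thm. 1.20 (1), (3) (p. 7)] -/
theorem psiJ_apply_natCast_ne_one_of_not_coprime (ψ : DirichletCharacter ℚ_[7] (7 * m)) {a : ℕ}
    (ha : ¬ a.Coprime (7 * m)) : ψ ((a : ℕ) : ZMod (7 * m)) ≠ 1 :=
  apply_natCast_ne_one_of_not_coprime ψ a ha

/-- For `ψ = χ·ω²` with `χ` PRIMITIVE mod `m` coprime to `7` and `ω ≠ 1`: `f(ψ⁻¹ω) = m·7`.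
[cite: KrizLi2019, Thm. 1.20 (p. 7)] [cite: Washington1997, Ch. 3] -/
theorem conductor_invMulOmega_psiJ (hm7 : m.Coprime 7) (hχp : χ.IsPrimitive) (hω1 : ω ≠ 1) :
    (invMulOmega (changeLevel (dvd_mul_left m 7) χ * changeLevel (dvd_mul_right 7 m) (ω ^ 2)) ω).conductor
      = m * 7 := by
  rw [invMulOmega_changeLevel_mul_changeLevel_sq]
  have hc7 := conductor_eq_of_prime_of_ne_one ω hω1
  have hcq : χ⁻¹.conductor = m := by rw [conductor_inv]; exact hχp
  have hcω : ω⁻¹.conductor = 7 := by rw [conductor_inv, hc7]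
  rw [conductor_changeLevel_mul_changeLevel _ _ χ⁻¹ ω⁻¹ (by rw [hcq, hcω]; exact hm7), hcq, hcω]

/-- **(1b)/(3b) for `ψ_m`: `(ψ⁻¹ω)(a) ≠ 1` (primitive value) whenever `a` is not coprime to `7m`.**
[cite: KrizLi2019, Thm. 1.20 (1), (3) (p. 7)] -/
theorem primVal_invMulOmega_psiJ_ne_one (hm7 : m.Coprime 7) (hω : IsTeichmullerCharacter ω)
    (hχp : χ.IsPrimitive) {a : ℕ} (ha : ¬ a.Coprime (7 * m)) :
    primVal (invMulOmega (changeLevel (dvd_mul_left m 7) χ *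
      changeLevel (dvd_mul_right 7 m) (ω ^ 2)) ω) a ≠ 1 := by
  apply primVal_ne_one_of_not_coprime
  rw [conductor_invMulOmega_psiJ ω χ hm7 hχp (ne_one_of_isTeichmullerCharacter (by norm_num) hω),
    mul_comm]
  exact ha

/-- **`ψ_m` is odd when `m ≡ 3 (mod 4)`**: `ψ(−1) = J(−1|m)·ω(−1)² = χ₄(m) = −1`.
[cite: KrizLi2019, §1.5 (p. 7, ψ₀ = ψε_K for ψ odd)] [cite: Cox2013, §1.C Lemma 1.14] -/
theorem psiJ_odd (hm4 : m % 4 = 3)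
    (hχ : ∀ a : ℕ, χ (a : ZMod m) = (jacobiSym (a : ℤ) m : ℚ_[7])) :
    (changeLevel (dvd_mul_left m 7) χ * changeLevel (dvd_mul_right 7 m) (ω ^ 2) :
      DirichletCharacter ℚ_[7] (7 * m)).Odd := by
  have hm3 : 3 ≤ m := by have := Nat.mod_le m 4; omega
  have h1lt : 1 < 7 * m := by omega
  have hneg : (-1 : ZMod (7 * m)) = ((7 * m - 1 : ℕ) : ZMod (7 * m)) := by
    rw [Nat.cast_sub (by omega), Nat.cast_one, ZMod.natCast_self, zero_sub]
  rw [DirichletCharacter.Odd, hneg, psiJ_apply ω χ hχ]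
  have hv : (((7 * m - 1 : ℕ) : ZMod (7 * m))).val = 7 * m - 1 := by
    rw [ZMod.val_natCast, Nat.mod_eq_of_lt (by omega)]
  rw [hv]
  -- `J(7m − 1 | m) = J(−1 | m) = χ₄(m) = −1`
  have hodd : Odd m := Nat.odd_iff.mpr (by omega)
  have hL : jacobiSym ((7 * m - 1 : ℕ) : ℤ) m = -1 := by
    have e : ((7 * m - 1 : ℕ) : ℤ) = -1 + (m : ℕ) * 7 := by push_cast [Nat.cast_sub (by omega : 1 ≤ 7 * m)]; ring
    rw [e, jacobiSym.mod_left, Int.add_mul_emod_self_left, ← jacobiSym.mod_left,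
      jacobiSym.at_neg_one hodd, ZMod.χ₄_nat_three_mod_four hm4]
  -- `ω(7m − 1)² = ω(−1)² = 1`
  have h6 : ((7 * m - 1 : ℕ) : ZMod 7) = -1 := by
    rw [Nat.cast_sub (by omega), Nat.cast_mul, Nat.cast_one, ZMod.natCast_self, zero_mul, zero_sub]
  rw [hL, h6, sq, ← map_mul, neg_mul_neg, one_mul, map_one]
  norm_num

/-- **The `hss` value identity for `ψ_m`: `ψ(ℓ) + ψ⁻¹(ℓ)ω(ℓ) = J(ℓ|m)·(ω(ℓ)² + ω(ℓ)⁵)` for `ℓ`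
coprime to `7m`** — the hypothesis `hψ` of `RouteUTraceForm.hss_twist_cm7`.
[cite: KrizLi2019, Thm. 1.20 and §2 (trace form a_ℓ ≡ ψ(ℓ) + ψ⁻¹ω(ℓ))] -/
theorem psiJ_traceIdentity
    (hχ : ∀ a : ℕ, χ (a : ZMod m) = (jacobiSym (a : ℤ) m : ℚ_[7])) (ℓ : ℕ) (h7 : ¬ 7 ∣ ℓ)
    (hℓ : ℓ.Coprime m) :
    (changeLevel (dvd_mul_left m 7) χ * changeLevel (dvd_mul_right 7 m) (ω ^ 2) :
        DirichletCharacter ℚ_[7] (7 * m)) (ℓ : ZMod (7 * m)) +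
      (changeLevel (dvd_mul_left m 7) χ * changeLevel (dvd_mul_right 7 m) (ω ^ 2) :
        DirichletCharacter ℚ_[7] (7 * m))⁻¹ (ℓ : ZMod (7 * m)) * ω (ℓ : ZMod 7) =
      (jacobiSym (ℓ : ℤ) m : ℚ_[7]) * (ω (ℓ : ZMod 7) ^ 2 + ω (ℓ : ZMod 7) ^ 5) := by
  set ψ : DirichletCharacter ℚ_[7] (7 * m) :=
    changeLevel (dvd_mul_left m 7) χ * changeLevel (dvd_mul_right 7 m) (ω ^ 2) with hψdef
  have hψℓ : ψ (ℓ : ZMod (7 * m)) = (jacobiSym (ℓ : ℤ) m : ℚ_[7]) * ω (ℓ : ZMod 7) ^ 2 := by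
    rw [hψdef, psiJ_apply ω χ hχ, natCast_val_zmod_seven_mul, jacobiSym_val_zmod_seven_mul]
  have hL2 : ((jacobiSym (ℓ : ℤ) m : ℤ) : ℚ_[7]) ^ 2 = 1 := jacobiSym_sq_eq_one_of_coprime hℓ
  have hω6 : ω (ℓ : ZMod 7) ^ 6 = 1 := by
    have := apply_pow_sub_one_eq_one ω (ℓ : ℤ) (by exact_mod_cast h7)
    rwa [Int.cast_natCast] at this
  have hinv : ψ⁻¹ (ℓ : ZMod (7 * m)) = (jacobiSym (ℓ : ℤ) m : ℚ_[7]) * ω (ℓ : ZMod 7) ^ 4 := by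
    rw [MulChar.inv_apply_eq_inv', hψℓ]
    apply inv_eq_of_mul_eq_one_right
    linear_combination (ω (ℓ : ZMod 7) ^ 6) * hL2 + hω6
  rw [hψℓ, hinv]
  ring

/-- **Values of `ψ_m⁻¹`: `ψ⁻¹(j) = J(j|m)·ω(j)⁴`** (the value hypothesis of the `θ₁`-certificate).
[cite: KrizLi2019, Thm. 1.20 (p. 8)] -/
theorem psiJ_inv_apply
    (hχ : ∀ a : ℕ, χ (a : ZMod m) = (jacobiSym (a : ℤ) m : ℚ_[7])) (j : ZMod (7 * m)) :
    (changeLevel (dvd_mul_left m 7) χ * changeLevel (dvd_mul_right 7 m) (ω ^ 2) :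
        DirichletCharacter ℚ_[7] (7 * m))⁻¹ j =
      (jacobiSym (j.val : ℤ) m : ℚ_[7]) * ω (j.val : ZMod 7) ^ 4 := by
  rw [MulChar.inv_apply_eq_inv', psiJ_apply ω χ hχ]
  by_cases h7 : 7 ∣ j.val
  · have h0 : (j.val : ZMod 7) = 0 := (ZMod.natCast_eq_zero_iff _ _).mpr h7
    rw [h0, MulChar.map_zero, zero_pow two_ne_zero, zero_pow (by norm_num), mul_zero, inv_zero]
  by_cases hmj : (j.val).Coprime m
  · have hL2 : ((jacobiSym (j.val : ℤ) m : ℤ) : ℚ_[7]) ^ 2 = 1 := jacobiSym_sq_eq_one_of_coprime hmj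
    have hω6 : ω (j.val : ZMod 7) ^ 6 = 1 := by
      have := apply_pow_sub_one_eq_one ω (j.val : ℤ) (by exact_mod_cast h7)
      rwa [Int.cast_natCast] at this
    apply inv_eq_of_mul_eq_one_right
    linear_combination (ω (j.val : ZMod 7) ^ 6) * hL2 + hω6
  · rw [jacobiSym_eq_zero_of_not_coprime hmj hm.out, Int.cast_zero, zero_mul, zero_mul, inv_zero]

/-- `ψ_m⁻¹` is primitive of level `7m`. [cite: KrizLi2019, Thm. 1.20 (p. 8)] -/
theorem psiJ_inv_isPrimitive (hm7 : m.Coprime 7) (hω : IsTeichmullerCharacter ω)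
    (hχp : χ.IsPrimitive) :
    (changeLevel (dvd_mul_left m 7) χ * changeLevel (dvd_mul_right 7 m) (ω ^ 2) :
        DirichletCharacter ℚ_[7] (7 * m))⁻¹.IsPrimitive := by
  rw [isPrimitive_def, conductor_inv]
  exact psiJ_isPrimitive ω χ hm7 hω hχp

/-- **Values of `θ₁ = χ↑·(ω⁴)↑` at level `7m`: `θ₁(j) = J(j|m)·ω(j)⁴`** (it IS `ψ_m⁻¹`).
[cite: KrizLi2019, Thm. 1.20 (p. 8)] -/
theorem thetaOneJ_apply
    (hχ : ∀ a : ℕ, χ (a : ZMod m) = (jacobiSym (a : ℤ) m : ℚ_[7])) (j : ZMod (7 * m)) :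
    (changeLevel (dvd_mul_left m 7) χ * changeLevel (dvd_mul_right 7 m) (ω ^ 4) :
      DirichletCharacter ℚ_[7] (7 * m)) j =
      (jacobiSym (j.val : ℤ) m : ℚ_[7]) * ω (j.val : ZMod 7) ^ 4 := by
  have hj : ((j.val : ℤ) : ZMod (7 * m)) = j := by rw [Int.cast_natCast, ZMod.natCast_zmod_val]
  by_cases hu : IsCoprime (j.val : ℤ) ((7 * m : ℕ) : ℤ)
  · conv_lhs => rw [← hj]
    rw [MulChar.mul_apply, changeLevel_eq_cast_of_dvd' _ _ hu, changeLevel_eq_cast_of_dvd' _ _ hu,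
      MulChar.pow_apply' _ (by norm_num), Int.cast_natCast, Int.cast_natCast, hχ]
  · have hnu : ¬ IsUnit j := by
      rw [← hj, ZMod.coe_int_isUnit_iff_isCoprime]; exact fun h => hu (by simpa [isCoprime_comm] using h)
    rw [MulChar.map_nonunit _ hnu]
    have h77 : ¬ (j.val).Coprime (7 * m) := fun h => hu (Nat.isCoprime_iff_coprime.mpr h)
    rw [Nat.coprime_mul_iff_right, not_and_or] at h77
    rcases h77 with h7 | hmm
    · have hd : 7 ∣ j.val := by
        rwa [Nat.coprime_comm, Nat.Prime.coprime_iff_not_dvd (by norm_num), not_not] at h7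
      have h0 : (j.val : ZMod 7) = 0 := (ZMod.natCast_eq_zero_iff _ _).mpr hd
      rw [h0, MulChar.map_zero, zero_pow (by norm_num), mul_zero]
    · rw [jacobiSym_eq_zero_of_not_coprime hmm hm.out, Int.cast_zero, zero_mul]

/-- `θ₁ = ψ_m⁻¹` as characters of level `7m`. [cite: KrizLi2019, Thm. 1.20 (p. 8)] -/
theorem thetaOneJ_eq_psiJ_inv (hχ : ∀ a : ℕ, χ (a : ZMod m) = (jacobiSym (a : ℤ) m : ℚ_[7])) :
    (changeLevel (dvd_mul_left m 7) χ * changeLevel (dvd_mul_right 7 m) (ω ^ 4) :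
      DirichletCharacter ℚ_[7] (7 * m)) =
      (changeLevel (dvd_mul_left m 7) χ * changeLevel (dvd_mul_right 7 m) (ω ^ 2))⁻¹ :=
  MulChar.ext' fun j => by rw [thetaOneJ_apply ω χ hχ, psiJ_inv_apply ω χ hχ]

/-! ## §3 The two Bernoulli characters of Thm. 1.20 at level `7m·r` -/

variable {r : ℕ} [hr : NeZero r] (κ : DirichletCharacter ℚ_[7] r)

/-- `7mr ≠ 0`. [folklore] -/
@[instance] theorem neZero_seven_mul_mul_level : NeZero (7 * m * r) :=
  ⟨Nat.mul_ne_zero (NeZero.ne _) hr.out⟩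

omit hr in
/-- **`bernoulliCharOne ψ_m κ = (ψ_m⁻¹)↑`** at level `7m·r` for `m ≡ 3 (mod 4)` (`ψ_m` odd, so
`ψ₀ = ψκ` and `ψ₀⁻¹κ = ψ⁻¹`). [cite: KrizLi2019, Thm. 1.20 (p. 8) and §1.5 (ψ₀)] -/
theorem bernoulliCharOne_psiJ (hm4 : m % 4 = 3)
    (hχ : ∀ a : ℕ, χ (a : ZMod m) = (jacobiSym (a : ℤ) m : ℚ_[7])) :
    bernoulliCharOne
        (changeLevel (dvd_mul_left m 7) χ * changeLevel (dvd_mul_right 7 m) (ω ^ 2)) κ =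
      changeLevel (dvd_mul_right (7 * m) r)
        (changeLevel (dvd_mul_left m 7) χ * changeLevel (dvd_mul_right 7 m) (ω ^ 2))⁻¹ := by
  have hodd := psiJ_odd ω χ hm4 hχ
  have key : ∀ a b : DirichletCharacter ℚ_[7] (7 * m * r), (a * b)⁻¹ * b = a⁻¹ := fun a b => by
    rw [mul_inv_rev, mul_comm b⁻¹ a⁻¹, inv_mul_cancel_right]
  rw [bernoulliCharOne, evenTwist, if_neg (hodd.not_even), key, map_inv]

omit hr in
/-- **`bernoulliCharTwo ψ_m κ ω = θ₂↑`** with `θ₂ := χ↑·κ↑·ω↑` at level `7m·r`.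
[cite: KrizLi2019, Thm. 1.20 (p. 8) and §1.5] -/
theorem bernoulliCharTwo_psiJ (hm4 : m % 4 = 3)
    (hχ : ∀ a : ℕ, χ (a : ZMod m) = (jacobiSym (a : ℤ) m : ℚ_[7])) :
    bernoulliCharTwo
        (changeLevel (dvd_mul_left m 7) χ * changeLevel (dvd_mul_right 7 m) (ω ^ 2)) κ ω =
      changeLevel (dvd_mul_right (7 * m * r) 7)
        (changeLevel ((dvd_mul_left m 7).trans (dvd_mul_right (7 * m) r)) χ *
          changeLevel (dvd_mul_left r (7 * m)) κ *
          changeLevel ((dvd_mul_right 7 m).trans (dvd_mul_right (7 * m) r)) ω) := by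
  have hodd := psiJ_odd ω χ hm4 hχ
  rw [bernoulliCharTwo, evenTwist, if_neg (hodd.not_even)]
  simp only [map_mul, map_pow, map_inv, ← changeLevel_trans]
  rw [mul_inv_eq_iff_eq_mul, sq]
  ext a
  simp only [MulChar.mul_apply]
  ring

/-- **Values of `θ₂ = χ↑·κ↑·ω↑` at level `7m·r`: `θ₂(j) = J(j|m)·J(j|r)·ω(j)`** when `κ` has the
Jacobi values `J(· | r)`. [cite: KrizLi2019, Thm. 1.20 (p. 8)] -/
theorem thetaTwoJ_apply
    (hχ : ∀ a : ℕ, χ (a : ZMod m) = (jacobiSym (a : ℤ) m : ℚ_[7]))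
    (hκ : ∀ a : ℕ, κ (a : ZMod r) = (jacobiSym (a : ℤ) r : ℚ_[7])) (j : ZMod (7 * m * r)) :
    (changeLevel ((dvd_mul_left m 7).trans (dvd_mul_right (7 * m) r)) χ *
        changeLevel (dvd_mul_left r (7 * m)) κ *
        changeLevel ((dvd_mul_right 7 m).trans (dvd_mul_right (7 * m) r)) ω :
        DirichletCharacter ℚ_[7] (7 * m * r)) j =
      ((jacobiSym (j.val : ℤ) m * jacobiSym (j.val : ℤ) r : ℤ) : ℚ_[7]) * ω (j.val : ZMod 7) ^ 1 := by
  have hj : ((j.val : ℤ) : ZMod (7 * m * r)) = j := by rw [Int.cast_natCast, ZMod.natCast_zmod_val]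
  by_cases hu : IsCoprime (j.val : ℤ) ((7 * m * r : ℕ) : ℤ)
  · conv_lhs => rw [← hj]
    rw [MulChar.mul_apply, MulChar.mul_apply, changeLevel_eq_cast_of_dvd' _ _ hu,
      changeLevel_eq_cast_of_dvd' _ _ hu, changeLevel_eq_cast_of_dvd' _ _ hu, Int.cast_natCast,
      Int.cast_natCast, Int.cast_natCast, hχ, hκ, pow_one, Int.cast_mul]
  · have hnu : ¬ IsUnit j := by
      rw [← hj, ZMod.coe_int_isUnit_iff_isCoprime]; exact fun h => hu (by simpa [isCoprime_comm] using h)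
    rw [MulChar.map_nonunit _ hnu]
    have h3 : ¬ (j.val).Coprime (7 * m * r) := fun h => hu (Nat.isCoprime_iff_coprime.mpr h)
    rw [Nat.coprime_mul_iff_right, Nat.coprime_mul_iff_right, not_and_or, not_and_or] at h3
    rcases h3 with (h7 | hmm) | hrr
    · have hd : 7 ∣ j.val := by
        rwa [Nat.coprime_comm, Nat.Prime.coprime_iff_not_dvd (by norm_num), not_not] at h7
      rw [(ZMod.natCast_eq_zero_iff _ _).mpr hd, MulChar.map_zero, pow_one, mul_zero]
    · rw [jacobiSym_eq_zero_of_not_coprime hmm hm.out, zero_mul, Int.cast_zero, zero_mul]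
    · rw [jacobiSym_eq_zero_of_not_coprime hrr hr.out, mul_zero, Int.cast_zero, zero_mul]

/-- **`θ₂` is primitive of conductor `7mr`** when `χ` is primitive mod `m`, `κ` primitive mod `r`,
`r` coprime to `7m`, `m` coprime to `7`. [cite: KrizLi2019, Thm. 1.20 (p. 8)] [cite: Washington1997, Ch. 3] -/
theorem thetaTwoJ_isPrimitive (hm7 : m.Coprime 7) (hr7 : r.Coprime 7) (hrm : r.Coprime m)
    (hω : IsTeichmullerCharacter ω) (hχp : χ.IsPrimitive) (hκp : κ.IsPrimitive) :
    (changeLevel ((dvd_mul_left m 7).trans (dvd_mul_right (7 * m) r)) χ *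
        changeLevel (dvd_mul_left r (7 * m)) κ *
        changeLevel ((dvd_mul_right 7 m).trans (dvd_mul_right (7 * m) r)) ω :
        DirichletCharacter ℚ_[7] (7 * m * r)).IsPrimitive := by
  have hcq : χ.conductor = m := hχp
  have hcr : κ.conductor = r := hκp
  have hω1 : ω ≠ 1 := fun h => teichmuller_sq_ne_one ω hω (by rw [h, one_pow])
  have hc7 := conductor_eq_of_prime_of_ne_one ω hω1
  have h12 : (changeLevel ((dvd_mul_left m 7).trans (dvd_mul_right (7 * m) r)) χ *
      changeLevel (dvd_mul_left r (7 * m)) κ : DirichletCharacter ℚ_[7] (7 * m * r)).conductor = m * r := by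
    rw [conductor_changeLevel_mul_changeLevel _ _ χ κ (by rw [hcq, hcr]; exact hrm.symm), hcq, hcr]
  rw [isPrimitive_def, conductor_mul_eq_mul_of_coprime _ _ (by
      rw [h12, conductor_changeLevel, hc7]; exact Nat.Coprime.mul_left hm7 hr7),
    h12, conductor_changeLevel, hc7]
  ring

end Psi

end Summit.BirchSwinnertonDyer.Rank1Residual.X12.O11.RouteU

end
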